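import Mathlib
import Literature.NumberTheory.Sieve.FriedlanderIwaniecPrimesCharacterDetection
import HarnessLib

/-!
# Gauss and Jacobi sums over `ℤ/pℤ` with complex values: moduli, shifts, square roots of even characters — PROVED

Topic `NumberTheory/GaussSums`.  Small complements to Mathlib's `gaussSum` / `jacobiSum` for the
prime field `ℤ/pℤ` and the standard additive character `e(x/p) = ZMod.stdAddChar`, all classical
(Ireland–Rosen, *A Classical Introduction to Modern Number Theory*, Ch. 8, §8.2–8.3):

* `sum_mulChar_mul_stdAddChar_mul`: the shifted Gauss sum `∑_a ψ(a) e(aw/p) = ψ⁻¹(w) g(ψ)` for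
  EVERY `w` (including `w = 0`, where both sides vanish since `ψ ≠ 1`);
* `norm_sq_gaussSum_stdAddChar`: `|g(ψ)|² = p` for `ψ ≠ 1` (Ireland–Rosen Prop. 8.2.2);
* `norm_sq_jacobiSum`: `|J(χ, φ)|² = p` when `χ, φ, χφ ≠ 1` (Ireland–Rosen Thm 8.3.1, Cor.);
* `MulChar.exists_mul_self_eq_of_apply_neg_one`: for `p` odd, a character `ψ` of `(ℤ/pℤ)ˣ` with
  `ψ(−1) = 1` is a square, `ψ = η²` (the character group is cyclic of even order `p − 1` and
  `−1 = g^{(p−1)/2}`; built with Mathlib's `MulChar.ofRootOfUnity`).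

These serve the elementary evaluation of the twisted second moment of Kloosterman sums
`∑_c θ(c) S(1,c;p)²` (`KloostermanTwistedMoment.lean`) behind Kunisky–Yu 2022, Theorem 4.22.

## References

* K. Ireland, M. Rosen, *A Classical Introduction to Modern Number Theory*, 2nd ed., GTM 84,
  Springer (1990), Ch. 8.  [IR90 in Kunisky–Yu]
* D. Kunisky, X. Yu, arXiv:2211.02713 (2022), Propositions 4.8, 4.9.  [KuniskyYu2022]
-/

noncomputable section

open Finset
open Literature.NumberTheory.Sieve.FriedlanderIwaniecPrimes

namespace Literature.NumberTheory.GaussSums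

section Prime

variable {p : ℕ} [hp : Fact p.Prime]

/-- **Shifted Gauss sums** (Kunisky–Yu 2022, Proposition 4.8; Ireland–Rosen Prop. 8.2.1): for a
non-trivial character `ψ` of `ℤ/pℤ` and every `w`, `∑_a ψ(a) e(aw/p) = ψ⁻¹(w) · g(ψ)` with
`g(ψ) = gaussSum ψ e`. [cite: KuniskyYu2022, Proposition 4.8] -/
theorem sum_mulChar_mul_stdAddChar_mul {ψ : MulChar (ZMod p) ℂ} (hψ : ψ ≠ 1) (w : ZMod p) :
    ∑ a : ZMod p, ψ a * ZMod.stdAddChar (a * w) = ψ⁻¹ w * gaussSum ψ ZMod.stdAddChar := by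
  by_cases hw : w = 0
  · subst hw
    simp only [mul_zero, AddChar.map_zero_eq_one, mul_one, MulChar.map_zero, zero_mul]
    exact MulChar.sum_eq_zero_of_ne_one hψ
  · have h := gaussSum_mulShift_eq ψ ZMod.stdAddChar (Units.mk0 w hw)
    rw [Units.val_mk0] at h
    rw [← h]
    unfold gaussSum
    refine Finset.sum_congr rfl fun a _ => ?_
    rw [AddChar.mulShift_apply, mul_comm w a]

/-- **`|g(ψ)|² = p`** for a non-trivial character of `ℤ/pℤ` (Ireland–Rosen Prop. 8.2.2;
Kunisky–Yu 2022, Proposition 4.9: "`|G(φ)| = √p`"). [cite: KuniskyYu2022, Proposition 4.9] -/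
theorem norm_sq_gaussSum_stdAddChar {ψ : MulChar (ZMod p) ℂ} (hψ : ψ ≠ 1) :
    ‖gaussSum ψ (ZMod.stdAddChar (N := p))‖ ^ 2 = p := by
  have h := gaussSum_mul_gaussSum_eq_card hψ (ZMod.isPrimitive_stdAddChar p)
  rw [ZMod.card, ← star_gaussSum_eq] at h
  have h2 : gaussSum ψ (ZMod.stdAddChar (N := p)) * star (gaussSum ψ (ZMod.stdAddChar (N := p))) =
      ((‖gaussSum ψ (ZMod.stdAddChar (N := p))‖ ^ 2 : ℝ) : ℂ) := by
    rw [Complex.star_def, Complex.mul_conj, Complex.normSq_eq_norm_sq]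
  rw [h2] at h
  exact_mod_cast h

/-- `‖g(ψ)‖ = √p` for `ψ ≠ 1`. [cite: KuniskyYu2022, Proposition 4.9] -/
theorem norm_gaussSum_stdAddChar {ψ : MulChar (ZMod p) ℂ} (hψ : ψ ≠ 1) :
    ‖gaussSum ψ (ZMod.stdAddChar (N := p))‖ = Real.sqrt p := by
  rw [← norm_sq_gaussSum_stdAddChar hψ, Real.sqrt_sq (norm_nonneg _)]

/-- Complex conjugation inverts both characters of a Jacobi sum:
`conj J(χ, φ) = J(χ⁻¹, φ⁻¹)`. [folklore] -/
theorem conj_jacobiSum (χ φ : MulChar (ZMod p) ℂ) :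
    (starRingEnd ℂ) (jacobiSum χ φ) = jacobiSum χ⁻¹ φ⁻¹ := by
  unfold jacobiSum
  rw [map_sum]
  refine Finset.sum_congr rfl fun x _ => ?_
  rw [map_mul]
  congr 1
  · exact MulChar.star_apply' χ x
  · exact MulChar.star_apply' φ (1 - x)

/-- **`|J(χ, φ)|² = p`** when `χ`, `φ` and `χφ` are non-trivial characters of `ℤ/pℤ`
(Ireland–Rosen, Theorem 8.3.1 and its Corollary). [folklore] -/
theorem norm_sq_jacobiSum {χ φ : MulChar (ZMod p) ℂ} (hχ : χ ≠ 1) (hφ : φ ≠ 1)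
    (hχφ : χ * φ ≠ 1) : ‖jacobiSum χ φ‖ ^ 2 = p := by
  have hch : ringChar ℂ ≠ ringChar (ZMod p) := by
    rw [ringChar.eq_zero, ZMod.ringChar_zmod_n]
    exact hp.out.ne_zero.symm
  have h := jacobiSum_mul_jacobiSum_inv hch hχ hφ hχφ
  rw [ZMod.card, ← conj_jacobiSum, Complex.mul_conj, Complex.normSq_eq_norm_sq] at h
  exact_mod_cast h

/-- `‖J(χ, φ)‖ = √p` under the same hypotheses. [folklore] -/
theorem norm_jacobiSum {χ φ : MulChar (ZMod p) ℂ} (hχ : χ ≠ 1) (hφ : φ ≠ 1)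
    (hχφ : χ * φ ≠ 1) : ‖jacobiSum χ φ‖ = Real.sqrt p := by
  rw [← norm_sq_jacobiSum hχ hφ hχφ, Real.sqrt_sq (norm_nonneg _)]

/-- A character takes the value `±1` at `−1`. [folklore] -/
theorem mulChar_neg_one_eq_one_or (ψ : MulChar (ZMod p) ℂ) : ψ (-1) = 1 ∨ ψ (-1) = -1 := by
  have h : ψ (-1) * ψ (-1) = 1 := by
    rw [← map_mul, neg_mul_neg, one_mul, map_one]
  exact mul_self_eq_one_iff.mp h

/-- **Even characters are squares**: for an odd prime `p`, a character `ψ` of `(ℤ/pℤ)ˣ` with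
`ψ(−1) = 1` is of the form `η²` (the character group is cyclic of even order `p − 1`, and
`−1 = g^{(p−1)/2}` for a generator `g`). [folklore] -/
theorem _root_.MulChar.exists_mul_self_eq_of_apply_neg_one (hp2 : p ≠ 2)
    (ψ : MulChar (ZMod p) ℂ) (hψ : ψ (-1) = 1) : ∃ η : MulChar (ZMod p) ℂ, η * η = ψ := by
  classical
  obtain ⟨g, hg⟩ := IsCyclic.exists_generator (α := (ZMod p)ˣ)
  set n : ℕ := Fintype.card (ZMod p)ˣ with hn
  have hn1 : n = p - 1 := by
    rw [hn, ZMod.card_units_eq_totient, Nat.totient_prime hp.out]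
  have hp3 : 3 ≤ p := by
    have := hp.out.two_le
    omega
  have hn0 : n ≠ 0 := by omega
  haveI : NeZero n := ⟨hn0⟩
  -- `n = 2m`
  obtain ⟨m, hm⟩ : 2 ∣ n := by
    rw [hn1]
    rcases hp.out.eq_two_or_odd' with h | h
    · exact absurd h hp2
    · obtain ⟨k, hk⟩ := h
      exact ⟨k, by omega⟩
  have hm0 : 0 < m := by omega
  -- `g ^ m = -1`
  have hordg : orderOf g = n := by
    rw [hn, ← Nat.card_eq_fintype_card]
    exact orderOf_eq_card_of_forall_mem_zpowers hg
  have hgn : g ^ n = 1 := by rw [← hordg, pow_orderOf_eq_one]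
  have hgm : ((g ^ m : (ZMod p)ˣ) : ZMod p) = -1 := by
    have hsq : ((g ^ m : (ZMod p)ˣ) : ZMod p) * ((g ^ m : (ZMod p)ˣ) : ZMod p) = 1 := by
      rw [← Units.val_mul, ← pow_add, show m + m = n by omega, hgn, Units.val_one]
    rcases mul_self_eq_one_iff.mp hsq with h1 | h1
    · exfalso
      have h2 : g ^ m = 1 := Units.val_eq_one.mp h1
      have h3 := orderOf_dvd_of_pow_eq_one h2
      rw [hordg] at h3
      have := Nat.le_of_dvd hm0 h3
      omega
    · exact h1
  -- a primitive `n`-th root of unity in `ℂ` and the exponent of `ψ g`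
  set ξ₀ : ℂ := Complex.exp (2 * Real.pi * Complex.I / n) with hξ₀def
  have hξ₀ : IsPrimitiveRoot ξ₀ n := Complex.isPrimitiveRoot_exp n hn0
  have hζn : ψ (g : ZMod p) ^ n = 1 := by
    rw [← map_pow, ← Units.val_pow_eq_pow_val, hgn, Units.val_one, map_one]
  obtain ⟨k, -, hkζ⟩ := hξ₀.eq_pow_of_pow_eq_one hζn
  -- evenness forces `k` even
  have h1 : ξ₀ ^ (k * m) = 1 := by
    rw [pow_mul, hkζ, ← map_pow, ← Units.val_pow_eq_pow_val, hgm, hψ]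
  have hdvd : n ∣ k * m := (hξ₀.pow_eq_one_iff_dvd _).mp h1
  obtain ⟨j, hj⟩ : 2 ∣ k := by
    rw [hm] at hdvd
    exact Nat.dvd_of_mul_dvd_mul_right hm0 hdvd
  -- the square root `η` with `η g = ξ₀ ^ j`
  have hξunit : IsUnit (ξ₀ ^ j) := (hξ₀.isUnit hn0).pow j
  have hξroot : hξunit.unit ∈ rootsOfUnity (Fintype.card (ZMod p)ˣ) ℂ := by
    rw [mem_rootsOfUnity, Units.ext_iff, Units.val_pow_eq_pow_val, IsUnit.unit_spec,
      Units.val_one, ← hn, ← pow_mul, mul_comm, pow_mul, hξ₀.pow_eq_one, one_pow]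
  refine ⟨MulChar.ofRootOfUnity hξroot hg, ?_⟩
  rw [MulChar.eq_iff hg, MulChar.mul_apply, MulChar.ofRootOfUnity_spec, IsUnit.unit_spec,
    ← hkζ, hj, ← pow_add]
  congr 1
  ring

/-- The quadratic character of `ℤ/pℤ` as a complex-valued multiplicative character. [folklore] -/
theorem quadraticChar_ringHomComp_apply (x : ZMod p) :
    (quadraticChar (ZMod p)).ringHomComp (Int.castRingHom ℂ) x =
      ((quadraticChar (ZMod p) x : ℤ) : ℂ) := by
  rw [MulChar.ringHomComp_apply]
  rfl

/-- The complexified quadratic character squares to the trivial character. [folklore] -/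
theorem quadraticChar_ringHomComp_mul_self :
    (quadraticChar (ZMod p)).ringHomComp (Int.castRingHom ℂ) *
      (quadraticChar (ZMod p)).ringHomComp (Int.castRingHom ℂ) = 1 := by
  rw [← sq]
  exact ((quadraticChar_isQuadratic (ZMod p)).comp _).sq_eq_one

/-- The complexified quadratic character is non-trivial for `p` odd. [folklore] -/
theorem quadraticChar_ringHomComp_ne_one (hp2 : p ≠ 2) :
    (quadraticChar (ZMod p)).ringHomComp (Int.castRingHom ℂ) ≠ 1 := by
  have hF : ringChar (ZMod p) ≠ 2 := by rwa [ZMod.ringChar_zmod_n]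
  obtain ⟨a, ha⟩ := quadraticChar_exists_neg_one hF
  intro h
  have h1 : (quadraticChar (ZMod p)).ringHomComp (Int.castRingHom ℂ) a = 1 := by
    rw [h]
    have hane : a ≠ 0 := by
      intro h0
      rw [h0, MulChar.map_zero] at ha
      norm_num at ha
    exact MulChar.one_apply (isUnit_iff_ne_zero.mpr hane)
  rw [quadraticChar_ringHomComp_apply, ha] at h1
  norm_num at h1

end Prime

end Literature.NumberTheory.GaussSums

end
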